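import Literature.Probability.LatticeModels.DartPhase
import Literature.Probability.LatticeModels.DirichletGreenFunction
import Literature.Probability.RandomPlanarGeometry.PlanarDomains
import Summits.CriticalPhenomena.CardyFormulaZ2.Theorems.CardySusyWardParafermionPrecompactKenyonDefs

/-!
# The Kenyon stencil identity (helper for stub `stub_greenMajorant`, crux `ParafermionPrecompact`)

Line `kenyon-stream-second-relation`, route `CardySusyWard`, item stmt-CriticalPhenomena-11293, lead
`prover-line-stmt-CriticalPhenomena-11293-0`. Vocabulary of `…KenyonDefs` (`classComp`, `vRes`,
`sRes`, `cornersAt`, `faceA`, `faceB`, `window`, `nearEdges`, `ex`, `classOffset`).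

THE KENYON STENCIL. Let `Φ` be any function on corners of `ℤ²`, `g_q(v) = Φ(v, v + c_q)` its
class-`q` component and `Δ g (y) = Σᵢ (g(y + eᵢ) + g(y - eᵢ)) - 4 g(y)` the graph Laplacian. There
are two tables `a, b : Fin 4 → Fin 2 → ℂ` with entries in `(±1 ± i)/2` (so of modulus
`1/√2 ≤ 1`) such that, whenever the vertex residual `vRes Φ` (DCS 2012 Prop. 8.6, coefficient
`+i`) vanishes on the `18` edges of the window of `y`,

  `Δ g_q (y) = Σ_{p = (y',i) ∈ window y} coef_q(y,p) · sRes Φ p`,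
  `coef_q(y,p) = a q i (𝟙[y' = y] - 𝟙[y' + eᵢ = y])`
  `             + b q i (𝟙[faceA p - c_q = y] - 𝟙[faceB p - c_q = y])`

(`stencil`): the Laplacian of a class component is a lattice DIVERGENCE (primal gradient plus the
class-shifted dual gradient) of the sum residuals `sRes` ("second relation" defects), modulo the
vertex relations — the discrete Cauchy–Riemann structure of Kenyon's stream function. It is an
exact linear identity between the `Φ`-values at the corners within distance `2` of `y` and six
vertex relations with explicit multipliers; it is proved at the origin class by class
(`stencil_origin`, reducing every corner to its four integer coordinates, `exists_coord_fun`,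
and closing with `linear_combination`), and transported to `y` by translating `Φ`.

MAIN THEOREM (`stencil_pairing`, the registered sub-goal of this helper file): the Green-pairing
form used by the Green majorant — for every finite `Λ`, every `Φ` with `vRes Φ = 0` on
`nearEdges Λ` and every `h : ℤ² → ℂ` vanishing off `Λ`,
`Σ_{y ∈ Λ} h(y) Δg_q(y) = Σ_{p ∈ nearEdges Λ} sRes Φ p · W_h(p)`,
`W_h(p) = a q i (h(y') - h(y'+eᵢ)) + b q i (h(faceA p - c_q) - h(faceB p - c_q))`,
with `‖a q i‖, ‖b q i‖ ≤ 1` (summation by parts: `coef_q(y,p) = 0` off the window of `y`,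
`coef_eq_zero_of_not_mem_window`; `Σ_{y ∈ Λ} h(y) 𝟙[u = y] = h(u)`). No definitions are
introduced: the tables are section parameters pinned by the hypotheses `ha`, `hb` and
existentially quantified in `stencil_pairing`.

References: R. Kenyon, Invent. Math. 150 (2002) 409–439, §3; R. Kenyon, Ann. Probab. 28 (2000)
759–795 (conformal invariance of domino tiling; discrete Cauchy–Riemann equations on `ℤ²`);
H. Duminil-Copin, S. Smirnov, Clay Math. Proc. 15 (2012), §8.3 [DuminilCopinSmirnov2012Lattice].
The coefficient tables were solved for and verified over `ℚ(i)` by exact linear algebra; every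
statement below is an elementary finite identity, tagged `[folklore]`.
-/

noncomputable section

namespace Summit.CriticalPhenomena.CardyFormulaZ2.Cruxes.ParafermionPrecompact.KenyonStreamSecondRelation

open scoped BigOperators
open Complex (I)
open _root_.Literature.Probability.LatticeModels

/-! ### Coordinates on `ℤ²` and the window

Equality of sites is tested on the two coordinates via `funext_iff` and `Fin.forall_fin_two`. -/

/-- `e₀ = (1, 0)`, first coordinate. [folklore] -/
theorem ex_zero_apply_zero : ex 0 0 = 1 := rfl

/-- `e₀ = (1, 0)`, second coordinate. [folklore] -/
theorem ex_zero_apply_one : ex 0 1 = 0 := rfl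

/-- `e₁ = (0, 1)`, first coordinate. [folklore] -/
theorem ex_one_apply_zero : ex 1 0 = 0 := rfl

/-- `e₁ = (0, 1)`, second coordinate. [folklore] -/
theorem ex_one_apply_one : ex 1 1 = 1 := rfl

/-- First coordinates of the class offsets `c_q ∈ {0, -e₀, -e₀-e₁, -e₁}`. [folklore] -/
theorem classOffset_apply_zero (q : Fin 4) : classOffset q 0 = ![0, -1, -1, 0] q := by
  fin_cases q <;> rfl

/-- Second coordinates of the class offsets. [folklore] -/
theorem classOffset_apply_one (q : Fin 4) : classOffset q 1 = ![0, 0, -1, -1] q := by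
  fin_cases q <;> rfl

/-- Membership in the window of `x`: the base site is within sup-distance `1` of `x`. [folklore] -/
theorem mem_window_iff {x : Site 2} {p : Site 2 × Fin 2} :
    p ∈ window x ↔ |p.1 0 - x 0| ≤ 1 ∧ |p.1 1 - x 1| ≤ 1 := by
  refine ⟨abs_le_of_mem_window, fun h => ?_⟩
  obtain ⟨h0, h1⟩ := h
  rw [abs_le] at h0 h1
  refine Finset.mem_image.2 ⟨(⟨(p.1 0 - x 0 + 1).toNat, by omega⟩,
    ⟨(p.1 1 - x 1 + 1).toNat, by omega⟩, p.2), Finset.mem_univ _, ?_⟩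
  refine Prod.ext (funext fun i => ?_) rfl
  fin_cases i
  · simp only [Fin.zero_eta, Fin.isValue, Pi.add_apply, Matrix.cons_val_zero]
    omega
  · simp only [Fin.mk_one, Fin.isValue, Pi.add_apply, Matrix.cons_val_one, Matrix.cons_val_zero]
    omega

/-- The window of a site of `Λ` lies in `nearEdges Λ`. [folklore] -/
theorem window_subset_nearEdges {Λ : Finset (Site 2)} {y : Site 2} (hy : y ∈ Λ) :
    window y ⊆ nearEdges Λ :=
  Finset.subset_biUnion_of_mem window hy

/-- A window sum is a sum over the `18` offsets `(s - 1, t - 1)`, `s, t ∈ {0, 1, 2}`. [folklore] -/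
theorem sum_window (y : Site 2) (F : Site 2 × Fin 2 → ℂ) :
    ∑ p ∈ window y, F p =
      ∑ t : Fin 3 × Fin 3 × Fin 2,
        F (y + ![((t.1 : ℕ) : ℤ) - 1, ((t.2.1 : ℕ) : ℤ) - 1], t.2.2) := by
  unfold window
  rw [Finset.sum_image]
  rintro ⟨s, t, j⟩ - ⟨s', t', j'⟩ - h
  simp only [Prod.mk.injEq, add_right_inj] at h
  obtain ⟨h1, rfl⟩ := h
  have h0 := congrFun h1 0
  have h1' := congrFun h1 1
  simp only [Matrix.cons_val_zero, Matrix.cons_val_one, Matrix.cons_val_fin_one, sub_left_inj,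
    Nat.cast_inj] at h0 h1'
  rw [Fin.val_inj.1 h0, Fin.val_inj.1 h1']

/-- Every corner function factors through the four integer coordinates of the corner. [folklore] -/
theorem exists_coord_fun (Ψ : Site 2 × Site 2 → ℂ) : ∃ Φ4 : ℤ → ℤ → ℤ → ℤ → ℂ,
    ∀ c : Site 2 × Site 2, Ψ c = Φ4 (c.1 0) (c.1 1) (c.2 0) (c.2 1) :=
  ⟨fun s t u v => Ψ (![s, t], ![u, v]), fun c => by
    simp only
    congr 1
    refine Prod.ext ?_ ?_ <;> funext j <;> fin_cases j <;> rfl⟩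

/-! ### The stencil identity

The coefficient tables `a` (primal gradient) and `b` (class-shifted dual gradient) are section
parameters pinned by `ha`, `hb`; `𝟙[P]` is written `if P then 1 else 0`. -/

section Stencil

variable {a b : Fin 4 → Fin 2 → ℂ}
  (ha : a = ![![(-1 - I) / 2, (-1 + I) / 2], ![(-1 + I) / 2, (1 + I) / 2],
    ![(1 + I) / 2, (1 - I) / 2], ![(1 - I) / 2, (-1 - I) / 2]])
  (hb : b = ![![(-1 + I) / 2, (-1 - I) / 2], ![(1 + I) / 2, (-1 + I) / 2],
    ![(1 - I) / 2, (1 + I) / 2], ![(-1 - I) / 2, (1 - I) / 2]])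

include ha hb in
/-- **The Kenyon stencil identity at the origin.** For a corner function `Ψ` whose vertex
residual vanishes on the `18` window edges of `0`, `Δ g_q (0)` equals the stencil sum of the
sum residuals. Proved class by class as an exact linear identity in the corner values
(coordinates via `exists_coord_fun`), using six vertex relations with explicit multipliers.
[folklore] -/
theorem stencil_origin (Ψ : Site 2 × Site 2 → ℂ) (q : Fin 4)
    (hv : ∀ t : Fin 3 × Fin 3 × Fin 2,
      vRes Ψ (![((t.1 : ℕ) : ℤ) - 1, ((t.2.1 : ℕ) : ℤ) - 1], t.2.2) = 0) :
    (∑ i : Fin 2, (classComp Ψ q (0 + ex i) + classComp Ψ q (0 - ex i))) - 4 * classComp Ψ q 0 =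
      ∑ t : Fin 3 × Fin 3 × Fin 2,
        (a q t.2.2 *
            ((if ![((t.1 : ℕ) : ℤ) - 1, ((t.2.1 : ℕ) : ℤ) - 1] = (0 : Site 2) then 1 else 0) -
              (if ![((t.1 : ℕ) : ℤ) - 1, ((t.2.1 : ℕ) : ℤ) - 1] + ex t.2.2 = (0 : Site 2)
                then 1 else 0)) +
          b q t.2.2 *
            ((if faceA (![((t.1 : ℕ) : ℤ) - 1, ((t.2.1 : ℕ) : ℤ) - 1], t.2.2) - classOffset q =
                (0 : Site 2) then 1 else 0) -
              (if faceB (![((t.1 : ℕ) : ℤ) - 1, ((t.2.1 : ℕ) : ℤ) - 1], t.2.2) - classOffset q =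
                (0 : Site 2) then 1 else 0))) *
        sRes Ψ (![((t.1 : ℕ) : ℤ) - 1, ((t.2.1 : ℕ) : ℤ) - 1], t.2.2) := by
  obtain ⟨Φ4, hΦ4⟩ := exists_coord_fun Ψ
  -- the ten vertex relations that occur (edge `(s - 1, t - 1)`, orientation `j`)
  have h000 := hv (0, 0, 0)
  have h001 := hv (0, 0, 1)
  have h010 := hv (0, 1, 0)
  have h011 := hv (0, 1, 1)
  have h020 := hv (0, 2, 0)
  have h100 := hv (1, 0, 0)
  have h101 := hv (1, 0, 1)
  have h110 := hv (1, 1, 0)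
  have h111 := hv (1, 1, 1)
  have h120 := hv (1, 2, 0)
  have h201 := hv (2, 0, 1)
  have h211 := hv (2, 1, 1)
  fin_cases q <;>
  simp only [Fintype.sum_prod_type, Fin.sum_univ_three, Fin.sum_univ_two, sRes, vRes, classComp,
    cornersAt, faceA, faceB, hΦ4, funext_iff, Fin.forall_fin_two, Fin.val_zero, Fin.val_one,
    Fin.val_two,
    Nat.cast_zero, Nat.cast_one, Nat.cast_ofNat, Matrix.cons_val_zero, Matrix.cons_val_one,
    Matrix.cons_val_two, Matrix.cons_val_three, Matrix.head_cons, Matrix.tail_cons, Pi.add_apply,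
    Pi.sub_apply, Pi.zero_apply, ex_zero_apply_zero, ex_zero_apply_one, ex_one_apply_zero,
    ex_one_apply_one, classOffset_apply_zero, classOffset_apply_one, Fin.isValue, Fin.zero_eta,
    Fin.mk_one, Fin.reduceFinMk, if_true, if_false, one_ne_zero, ha, hb]
      at h000 h001 h010 h011 h020 h100 h101 h110 h111 h120 h201 h211 ⊢ <;>
  norm_num only [true_and, false_and, and_true, and_false, if_true, if_false, sub_zero, zero_sub,
    sub_self, mul_zero, zero_mul, add_zero, zero_add]
      at h000 h001 h010 h011 h020 h100 h101 h110 h111 h120 h201 h211 ⊢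
  · linear_combination (norm := skip) (1 - I) / 2 * h010 + (-1 - I) / 2 * h101 + (-1) * h110 +
      1 * h111 + (1 + I) / 2 * h120 + (-1 + I) / 2 * h211
    ring_nf
    rw [Complex.I_sq]
    ring
  · linear_combination (norm := skip) (-I) * h010 + (1 - I) / 2 * h011 + (1 + I) / 2 * h020 +
      (-1 - I) / 2 * h101 + (-1 + I) / 2 * h110 + I * h111
    ring_nf
    rw [Complex.I_sq]
    ring
  · linear_combination (norm := skip) (-1 - I) / 2 * h000 + (1 - I) / 2 * h001 + 1 * h010 +
      (-1) * h101 + (-1 + I) / 2 * h110 + (1 + I) / 2 * h111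
    ring_nf
    rw [Complex.I_sq]
    ring
  · linear_combination (norm := skip) (1 - I) / 2 * h010 + (-1 - I) / 2 * h100 + (-I) * h101 +
      I * h110 + (1 + I) / 2 * h111 + (-1 + I) / 2 * h201
    ring_nf
    rw [Complex.I_sq]
    ring

/-- Corners at a translated edge. [folklore] -/
theorem cornersAt_add (y v : Site 2) (j : Fin 2) (k : Fin 4) :
    cornersAt (y + v) j k = (y + (cornersAt v j k).1, y + (cornersAt v j k).2) := by
  fin_cases j <;> fin_cases k <;>
    simp [cornersAt, add_assoc, add_sub_assoc]

/-- Sum residual of the translate `c ↦ Φ (y + c)`. [folklore] -/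
theorem sRes_translate (Φ : Site 2 × Site 2 → ℂ) (y v : Site 2) (j : Fin 2) :
    sRes (fun c => Φ (y + c.1, y + c.2)) (v, j) = sRes Φ (y + v, j) := by
  simp only [sRes, cornersAt_add]

/-- Vertex residual of the translate. [folklore] -/
theorem vRes_translate (Φ : Site 2 × Site 2 → ℂ) (y v : Site 2) (j : Fin 2) :
    vRes (fun c => Φ (y + c.1, y + c.2)) (v, j) = vRes Φ (y + v, j) := by
  simp only [vRes, cornersAt_add]

/-- Class components of the translate. [folklore] -/
theorem classComp_translate (Φ : Site 2 × Site 2 → ℂ) (y : Site 2) (q : Fin 4) (v : Site 2) :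
    classComp (fun c => Φ (y + c.1, y + c.2)) q v = classComp Φ q (y + v) := by
  simp only [classComp, add_assoc]

/-- `faceB` commutes with translations. [folklore] -/
theorem faceB_add (y v : Site 2) (j : Fin 2) : faceB (y + v, j) = y + faceB (v, j) := by
  unfold faceB
  split_ifs <;> simp only [add_sub_assoc]

include ha hb in
/-- **The Kenyon stencil identity.** If the vertex residual of `Φ` vanishes on the window of `y`,
then `Δ g_q (y) = Σ_{p ∈ window y} coef_q(y,p) · sRes Φ p`. [folklore] -/
theorem stencil (Φ : Site 2 × Site 2 → ℂ) (q : Fin 4) (y : Site 2)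
    (hv : ∀ p ∈ window y, vRes Φ p = 0) :
    (∑ i : Fin 2, (classComp Φ q (y + ex i) + classComp Φ q (y - ex i))) - 4 * classComp Φ q y =
      ∑ p ∈ window y,
        (a q p.2 * ((if p.1 = y then 1 else 0) - (if p.1 + ex p.2 = y then 1 else 0)) +
          b q p.2 * ((if faceA p - classOffset q = y then 1 else 0) -
            (if faceB p - classOffset q = y then 1 else 0))) * sRes Φ p := by
  have key := stencil_origin ha hb (fun c => Φ (y + c.1, y + c.2)) q fun t => by
    rw [vRes_translate]
    exact hv _ (Finset.mem_image_of_mem _ (Finset.mem_univ t))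
  simp only [classComp_translate, add_zero, zero_add, zero_sub, ← sub_eq_add_neg] at key
  rw [key, sum_window]
  refine Finset.sum_congr rfl fun t _ => ?_
  rw [sRes_translate]
  simp only [faceA, faceB_add, add_assoc, add_sub_assoc, add_eq_left]
  rfl

/-- Off the window of `y` the stencil coefficient `coef_q(y,p)` vanishes (each of its four
indicators places `p` in the window). [folklore] -/
theorem coef_eq_zero_of_not_mem_window (a b : Fin 4 → Fin 2 → ℂ) (q : Fin 4) {y : Site 2}
    {p : Site 2 × Fin 2} (hp : p ∉ window y) :
    a q p.2 * ((if p.1 = y then 1 else 0) - (if p.1 + ex p.2 = y then 1 else 0)) +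
        b q p.2 * ((if faceA p - classOffset q = y then 1 else 0) -
          (if faceB p - classOffset q = y then 1 else 0)) = (0 : ℂ) := by
  obtain ⟨u, j⟩ := p
  rw [mem_window_iff, abs_le, abs_le] at hp
  have H : ∀ (P : Prop) (_ : Decidable P),
      (P → (-1 ≤ u 0 - y 0 ∧ u 0 - y 0 ≤ 1) ∧ (-1 ≤ u 1 - y 1 ∧ u 1 - y 1 ≤ 1)) →
      (if P then (1 : ℂ) else 0) = 0 := fun P _ h => if_neg fun hP => hp (h hP)
  rw [H, H, H, H]
  · ring
  all_goals
    intro h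
    rw [funext_iff, Fin.forall_fin_two] at h
    fin_cases j <;> fin_cases q <;>
      (try simp [faceA, faceB, classOffset_apply_zero, classOffset_apply_one, ex_zero_apply_zero,
        ex_zero_apply_one, ex_one_apply_zero, ex_one_apply_one] at h) <;> omega

/-- `Σ_{y ∈ Λ} h(y) 𝟙[u = y] = h(u)` for `h` vanishing off `Λ`. [folklore] -/
theorem sum_mul_ite_eq (Λ : Finset (Site 2)) (h : Site 2 → ℂ) (h0 : ∀ y ∉ Λ, h y = 0)
    (u : Site 2) : ∑ y ∈ Λ, h y * (if u = y then 1 else 0) = h u := by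
  by_cases hu : u ∈ Λ
  · rw [Finset.sum_eq_single_of_mem u hu fun y _ hne => by
      rw [if_neg (Ne.symm hne), mul_zero], if_pos rfl, mul_one]
  · rw [Finset.sum_eq_zero fun y hy => by
        rw [if_neg (fun e : u = y => hu (by rw [e]; exact hy)), mul_zero], h0 u hu]

/-- Summation by parts of the stencil coefficient against `h` (vanishing off `Λ`): the result is
the weight `a q i (h(y') - h(y'+eᵢ)) + b q i (h(faceA p - c_q) - h(faceB p - c_q))`. [folklore] -/
theorem sum_mul_coef (a b : Fin 4 → Fin 2 → ℂ) (Λ : Finset (Site 2)) (h : Site 2 → ℂ)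
    (h0 : ∀ y ∉ Λ, h y = 0) (q : Fin 4) (p : Site 2 × Fin 2) :
    ∑ y ∈ Λ, h y *
        (a q p.2 * ((if p.1 = y then 1 else 0) - (if p.1 + ex p.2 = y then 1 else 0)) +
          b q p.2 * ((if faceA p - classOffset q = y then 1 else 0) -
            (if faceB p - classOffset q = y then 1 else 0))) =
      a q p.2 * (h p.1 - h (p.1 + ex p.2)) +
        b q p.2 * (h (faceA p - classOffset q) - h (faceB p - classOffset q)) := by
  have e : ∀ y, h y *
      (a q p.2 * ((if p.1 = y then 1 else 0) - (if p.1 + ex p.2 = y then 1 else 0)) +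
        b q p.2 * ((if faceA p - classOffset q = y then 1 else 0) -
          (if faceB p - classOffset q = y then 1 else 0))) =
      a q p.2 * (h y * (if p.1 = y then 1 else 0)) -
        a q p.2 * (h y * (if p.1 + ex p.2 = y then 1 else 0)) +
      (b q p.2 * (h y * (if faceA p - classOffset q = y then 1 else 0)) -
        b q p.2 * (h y * (if faceB p - classOffset q = y then 1 else 0))) := fun y => by ring
  rw [Finset.sum_congr rfl fun y _ => e y, Finset.sum_add_distrib, Finset.sum_sub_distrib,
    Finset.sum_sub_distrib, ← Finset.mul_sum, ← Finset.mul_sum, ← Finset.mul_sum,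
    ← Finset.mul_sum, sum_mul_ite_eq Λ h h0, sum_mul_ite_eq Λ h h0, sum_mul_ite_eq Λ h h0,
    sum_mul_ite_eq Λ h h0, mul_sub, mul_sub]

include ha hb in
/-- The Green-pairing form of the stencil for the pinned tables. [folklore] -/
theorem stencil_pairing_of (Λ : Finset (Site 2)) (Φ : Site 2 × Site 2 → ℂ)
    (hv : ∀ p ∈ nearEdges Λ, vRes Φ p = 0) (q : Fin 4) (h : Site 2 → ℂ)
    (h0 : ∀ y ∉ Λ, h y = 0) :
    ∑ y ∈ Λ, h y *
        ((∑ i : Fin 2, (classComp Φ q (y + ex i) + classComp Φ q (y - ex i))) -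
          4 * classComp Φ q y) =
      ∑ p ∈ nearEdges Λ, sRes Φ p * (a q p.2 * (h p.1 - h (p.1 + ex p.2)) +
        b q p.2 * (h (faceA p - classOffset q) - h (faceB p - classOffset q))) := by
  calc ∑ y ∈ Λ, h y * ((∑ i : Fin 2, (classComp Φ q (y + ex i) + classComp Φ q (y - ex i))) -
          4 * classComp Φ q y)
      = ∑ y ∈ Λ, ∑ p ∈ nearEdges Λ, h y *
          (a q p.2 * ((if p.1 = y then 1 else 0) - (if p.1 + ex p.2 = y then 1 else 0)) +
            b q p.2 * ((if faceA p - classOffset q = y then 1 else 0) -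
              (if faceB p - classOffset q = y then 1 else 0))) * sRes Φ p := by
        refine Finset.sum_congr rfl fun y hy => ?_
        rw [stencil ha hb Φ q y fun p hp => hv p (window_subset_nearEdges hy hp),
          ← Finset.sum_subset (window_subset_nearEdges hy) fun p _ hp => by
            rw [coef_eq_zero_of_not_mem_window a b q hp, mul_zero, zero_mul], Finset.mul_sum]
        refine Finset.sum_congr rfl fun p _ => ?_
        rw [mul_assoc]
    _ = ∑ p ∈ nearEdges Λ, (∑ y ∈ Λ, h y *
          (a q p.2 * ((if p.1 = y then 1 else 0) - (if p.1 + ex p.2 = y then 1 else 0)) +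
            b q p.2 * ((if faceA p - classOffset q = y then 1 else 0) -
              (if faceB p - classOffset q = y then 1 else 0)))) * sRes Φ p := by
        rw [Finset.sum_comm]
        refine Finset.sum_congr rfl fun p _ => ?_
        rw [Finset.sum_mul]
    _ = _ := by
        refine Finset.sum_congr rfl fun p _ => ?_
        rw [sum_mul_coef a b Λ h h0, mul_comm]

end Stencil

/-- `‖(s ± t)/2‖ ≤ 1` for `‖s‖, ‖t‖ ≤ 1`. [folklore] -/
theorem norm_half_combo_le {s t : ℂ} (hs : ‖s‖ ≤ 1) (ht : ‖t‖ ≤ 1) :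
    ‖(s + t) / 2‖ ≤ 1 ∧ ‖(s - t) / 2‖ ≤ 1 := by
  rw [norm_div, norm_div, Complex.norm_two, div_le_one two_pos, div_le_one two_pos]
  exact ⟨(norm_add_le s t).trans (by linarith), (norm_sub_le s t).trans (by linarith)⟩

/-- **Main theorem of this file (registered sub-goal `stencil_pairing`): the Kenyon stencil in
Green-pairing form.** There are coefficient tables `a, b : Fin 4 → Fin 2 → ℂ` of modulus `≤ 1`
such that for every finite `Λ ⊆ ℤ²`, every corner function `Φ` whose vertex residual vanishes
on `nearEdges Λ`, every class `q` and every `h : ℤ² → ℂ` vanishing off `Λ`,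
`Σ_{y ∈ Λ} h(y) Δg_q(y) = Σ_{p ∈ nearEdges Λ} sRes Φ p · W_h(p)` with
`W_h(p) = a q i (h(y') - h(y'+eᵢ)) + b q i (h(faceA p - c_q) - h(faceB p - c_q))`
(`p = (y', i)`). [folklore] -/
theorem stencil_pairing :
    ∃ a b : Fin 4 → Fin 2 → ℂ, (∀ (q : Fin 4) (i : Fin 2), ‖a q i‖ ≤ 1 ∧ ‖b q i‖ ≤ 1) ∧
      ∀ (Λ : Finset (Site 2)) (Φ : Site 2 × Site 2 → ℂ), (∀ p ∈ nearEdges Λ, vRes Φ p = 0) →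
        ∀ (q : Fin 4) (h : Site 2 → ℂ), (∀ y ∉ Λ, h y = 0) →
          ∑ y ∈ Λ, h y *
              ((∑ i : Fin 2, (classComp Φ q (y + ex i) + classComp Φ q (y - ex i))) -
                4 * classComp Φ q y) =
            ∑ p ∈ nearEdges Λ, sRes Φ p * (a q p.2 * (h p.1 - h (p.1 + ex p.2)) +
              b q p.2 * (h (faceA p - classOffset q) - h (faceB p - classOffset q))) := by
  have h1 : ‖(1 : ℂ)‖ ≤ 1 := by simp
  have hm : ‖(-1 : ℂ)‖ ≤ 1 := by simp
  have hI : ‖I‖ ≤ 1 := by simp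
  have A := norm_half_combo_le h1 hI
  have B := norm_half_combo_le hm hI
  refine ⟨_, _, fun q i => ?_, fun Λ Φ hv q h h0 => stencil_pairing_of rfl rfl Λ Φ hv q h h0⟩
  fin_cases q <;> fin_cases i <;>
    simp only [Fin.zero_eta, Fin.mk_one, Fin.reduceFinMk, Fin.isValue, Matrix.cons_val_zero,
      Matrix.cons_val_one, Matrix.cons_val_two, Matrix.cons_val_three, Matrix.head_cons,
      Matrix.tail_cons]
  exacts [⟨B.2, B.1⟩, ⟨B.1, B.2⟩, ⟨B.1, A.1⟩, ⟨A.1, B.1⟩, ⟨A.1, A.2⟩, ⟨A.2, A.1⟩, ⟨A.2, B.2⟩,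
    ⟨B.2, A.2⟩]

end Summit.CriticalPhenomena.CardyFormulaZ2.Cruxes.ParafermionPrecompact.KenyonStreamSecondRelation

end
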